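import Mathlib.Topology.Connected.PathConnected
import Mathlib.MeasureTheory.Measure.Real
import Literature.Probability.Percolation.VoronoiCrossing
import Literature.Probability.RandomPlanarGeometry.PlanarDomains
import HarnessLib

/-!
# Separating events and annealed separating probabilities for Voronoi percolation

Topic `Probability/Percolation`. Definitions wanted by the crux `Target` (stmt-CriticalPhenomena-6431)
of route `Summits/CriticalPhenomena/CardyFormulaZ2/Theses/CardyFlipRusso` (conjunct (i): Cardy's
formula for annealed Poisson–Voronoi percolation, the Benjamini–Schramm conjecture), line `Sketch`
(`Cruxes/Target/Lines/Sketch.lean`): its open stub `stub_voronoiSepData` asks for Bollobás–Riordan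
*separating data* (`IsSeparatingData`, `SmirnovSeparatingData.lean`) sandwiching the annealed
crossing functional, and such data are, as in the proved triangular case (`TriMarkedDomain.sepProb`,
`TriDiscreteDomain.lean`) and the Union-Jack case (`ujSepProb`, `UnionJackSeparating.lean`), the
probabilities of SEPARATING EVENTS. This file supplies the continuum Voronoi version of
Bollobás–Riordan's separating event (Ch. 7 §7.2.4, p. 176: "`G_δ` contains an open
`A_{i+1}`–`A_{i+2}` path separating `z` from `Aᵢ`", probabilities (9) p. 180) in the
continuum-path vocabulary of the accepted `voronoiCrossing` (`VoronoiCrossing.lean`): black points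
`blackRegion B W` of two nucleus sets (Bollobás–Riordan Ch. 8 §8.1), paths in `closure Ω`.

## Contents

* `IsCutBetween X C z A` — inside the ambient set `X`, the set `C` separates the point `z` from
  the set `A`: `z ∉ C` and no point of `A` is joined to `z` by a path in `X ∖ C` (Mathlib
  `JoinedIn`). API: `IsCutBetween.not_mem`, `.mono_cut`, `.mono_target`, `isCutBetween_empty_target`.
* `voronoiSepEvent D δ i z B W` — for a 3-marked Jordan domain `D = (Ω; A₀, A₁, A₂)`, a scale
  `δ`, an index `i : Fin 3`, a point `z` and nucleus sets `B` (black), `W` (white): there is a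
  path in `closure Ω` through points whose rescaled position `w/δ` is black, from the arc
  `A_{i+1}` to the arc `A_{i+2}`, whose trace separates `z` from the arc `Aᵢ` inside `closure Ω`
  (indices mod `3`).
* `voronoiSepProb P D δ i z` — its probability under a joint law `P` of the pair (black nuclei,
  white nuclei) of point configurations (`PointConfig ℂ × PointConfig ℂ`; for annealed
  Poisson–Voronoi percolation `P = PB.prod PW` with `PB`, `PW` Poisson of Lebesgue intensity —
  the law is a parameter so that jittered / thinned nuclei laws are covered too);
  `Measure.real`, so no measurability is presupposed. API: `voronoiSepProb_nonneg`,
  `voronoiSepProb_le_one`, `voronoiSepProb_mem_Icc`, unfolding lemmas.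

## Design choices / junk values

* Continuum separation through `JoinedIn (closure Ω ∖ range γ)`: a path-free formulation of
  Bollobás–Riordan's dual-path separation (their p. 176 uses chains of dual edges avoiding the
  bonds of the open path; for the locally polygonal black regions of locally finite nuclei the
  two notions of connectivity agree, cf. the docstring of `voronoiCrossing`). The separating path
  may start or end at a marked point shared with `Aᵢ`; points of `Aᵢ` lying ON the path count as
  separated (no path in the complement reaches them), as in the source where the separating path
  may use sites adjacent to `Aᵢ`.
* `z` on the separating path is NOT separated (`z ∉ C` is part of `IsCutBetween`), matching
  "separating `z` from `Aᵢ`" for `z` a point of the domain off the path; for `z ∉ closure Ω` every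
  path from `z` leaves `closure Ω ∖ C` immediately unless it is constant, so such `z` are
  separated from `Aᵢ` as soon as `z ∉ Aᵢ ∪ C` — a junk regime consumers avoid (`z ∈ Ω`).
* Nuclei are plain sets (as in `voronoiCrossing`); `infDist · ∅ = 0` makes every point black
  when `B = ∅` (junk, probability zero under Poisson laws).
* No named fact is introduced; nothing here is specific to Poisson laws.

## References

* B. Bollobás, O. Riordan, *Percolation*, Cambridge University Press (2006), Ch. 7 §7.2.4
  (separating events, p. 176; (9) p. 180), Ch. 8 §§8.1–8.2 (random Voronoi percolation).
* I. Benjamini, O. Schramm, *Conformal invariance of Voronoi percolation*, Comm. Math. Phys.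
  197 (1998) 75–107, §1.
* S. Smirnov, *Critical percolation in the plane*, C. R. Acad. Sci. Paris 333 (2001), §2–3.
-/

noncomputable section

open Set Metric MeasureTheory

namespace Literature.Probability.Percolation

/-! ### Separation of a point from a set by a cut, inside an ambient set -/

/-- **`C` cuts `z` from `A` inside `X`**: the point `z` is not on the cut `C`, and no point of `A`
can be reached from `z` by a (continuous) path inside `X ∖ C` (Mathlib `JoinedIn`). With
`X = closure Ω`, `C` the trace of an open path and `A` a boundary arc this is the separation
clause of Bollobás–Riordan's separating event (Ch. 7 §7.2.4, p. 176), in continuum form.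
[cite: BollobasRiordan2006, Ch. 7 §7.2.4 p. 176] -/
def IsCutBetween (X C : Set ℂ) (z : ℂ) (A : Set ℂ) : Prop :=
  z ∉ C ∧ ∀ a ∈ A, ¬ JoinedIn (X \ C) z a

namespace IsCutBetween

variable {X C C' A A' : Set ℂ} {z : ℂ}

/-- The separated point is off the cut. [folklore] -/
theorem not_mem (h : IsCutBetween X C z A) : z ∉ C := h.1

/-- No point of the target is joined to `z` off the cut. [folklore] -/
theorem not_joinedIn (h : IsCutBetween X C z A) {a : ℂ} (ha : a ∈ A) : ¬ JoinedIn (X \ C) z a :=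
  h.2 a ha

/-- A larger cut still avoiding `z` separates at least as much. [folklore] -/
theorem mono_cut (h : IsCutBetween X C z A) (hCC' : C ⊆ C') (hz : z ∉ C') : IsCutBetween X C' z A :=
  ⟨hz, fun a ha hJ => h.2 a ha (hJ.mono (Set.sdiff_subset_sdiff_right hCC'))⟩

/-- Separation from a set is separation from each of its subsets. [folklore] -/
theorem mono_target (h : IsCutBetween X C z A) (hA : A' ⊆ A) : IsCutBetween X C z A' :=
  ⟨h.1, fun a ha => h.2 a (hA ha)⟩

/-- Shrinking the ambient set preserves separation. [folklore] -/
theorem anti_ambient {X' : Set ℂ} (h : IsCutBetween X C z A) (hX : X' ⊆ X) : IsCutBetween X' C z A :=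
  ⟨h.1, fun a ha hJ => h.2 a ha (hJ.mono (Set.sdiff_subset_sdiff_left hX))⟩

end IsCutBetween

/-- Every cut avoiding `z` separates `z` from the empty set. [folklore] -/
theorem isCutBetween_empty_target {X C : Set ℂ} {z : ℂ} (hz : z ∉ C) : IsCutBetween X C z ∅ :=
  ⟨hz, fun _ ha => ha.elim⟩

/-- A point of the target lying off the cut and equal to `z` is never separated (the constant path).
[folklore] -/
theorem not_isCutBetween_of_mem {X C A : Set ℂ} {z : ℂ} (hzX : z ∈ X) (hzA : z ∈ A) :
    ¬ IsCutBetween X C z A := fun h =>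
  h.2 z hzA (JoinedIn.refl ⟨hzX, h.1⟩)

/-! ### The Voronoi separating event of a 3-marked domain -/

section SepEvent

open Literature.Probability.RandomPlanarGeometry (MarkedDomain)

variable (D : MarkedDomain 3)

/-- **The continuum Voronoi separating event `Eⁱ(z)`** of the 3-marked Jordan domain
`D = (Ω; A₀, A₁, A₂)` at scale `δ`, for black nuclei `B` and white nuclei `W`: there are a point
`x` of the arc `A_{i+1}`, a point `y` of the arc `A_{i+2}` and a path `γ` from `x` to `y` inside
`closure Ω` all of whose points are black at scale `δ` (`w/δ ∈ blackRegion B W`, as in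
`voronoiCrossing`), whose trace cuts `z` from the arc `Aᵢ` inside `closure Ω` — Bollobás–Riordan's
"`G_δ` contains an open `A_{i+1}`–`A_{i+2}` path separating `z` from `Aᵢ`" (Ch. 7 §7.2.4 p. 176,
indices mod `3`) for the black points of random Voronoi percolation (Ch. 8 §8.1).
[cite: BollobasRiordan2006, Ch. 7 §7.2.4 p. 176] -/
def voronoiSepEvent (δ : ℝ) (i : Fin 3) (z : ℂ) (B W : Set ℂ) : Prop :=
  ∃ x ∈ D.arc (i + 1), ∃ y ∈ D.arc (i + 2), ∃ γ : Path x y,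
    (∀ t, γ t ∈ closure D.carrier ∩ {w | w / (δ : ℂ) ∈ blackRegion B W}) ∧
    IsCutBetween (closure D.carrier) (range γ) z (D.arc i)

variable {D}

/-- Unfolding lemma for `voronoiSepEvent`. [cite: BollobasRiordan2006, Ch. 7 §7.2.4 p. 176] -/
theorem voronoiSepEvent_iff {δ : ℝ} {i : Fin 3} {z : ℂ} {B W : Set ℂ} :
    voronoiSepEvent D δ i z B W ↔
      ∃ x ∈ D.arc (i + 1), ∃ y ∈ D.arc (i + 2), ∃ γ : Path x y,
        (∀ t, γ t ∈ closure D.carrier ∩ {w | w / (δ : ℂ) ∈ blackRegion B W}) ∧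
        IsCutBetween (closure D.carrier) (range γ) z (D.arc i) :=
  Iff.rfl

/-- A separating path is in particular a black crossing of `closure Ω` between the two arcs
`A_{i+1}`, `A_{i+2}` (the accepted `voronoiCrossing`). [cite: BollobasRiordan2006, Ch. 7 §7.2.4 p. 176] -/
theorem voronoiSepEvent.voronoiCrossing {δ : ℝ} {i : Fin 3} {z : ℂ} {B W : Set ℂ}
    (h : voronoiSepEvent D δ i z B W) :
    voronoiCrossing D.carrier (D.arc (i + 1)) (D.arc (i + 2)) δ B W := by
  obtain ⟨x, hx, y, hy, γ, hγ, -⟩ := h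
  exact ⟨x, hx, y, hy, ⟨γ, hγ⟩⟩

/-- The separated point is not on the separating path; in particular it is not one of its
endpoints. [folklore] -/
theorem voronoiSepEvent.not_mem_range {δ : ℝ} {i : Fin 3} {z : ℂ} {B W : Set ℂ}
    (h : voronoiSepEvent D δ i z B W) :
    ∃ x ∈ D.arc (i + 1), ∃ y ∈ D.arc (i + 2), ∃ γ : Path x y, z ∉ range γ := by
  obtain ⟨x, hx, y, hy, γ, -, hcut⟩ := h
  exact ⟨x, hx, y, hy, γ, hcut.1⟩

/-- **Black-increasing**: adding black nuclei and deleting white nuclei preserves the separating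
event (the same separating path stays black; Bollobás–Riordan Ch. 8 §8.2, "any event defined by
the existence of certain black sets is increasing"). The non-emptiness hypotheses exclude the junk
value `infDist · ∅ = 0`. [cite: BollobasRiordan2006, Ch. 8 §8.2] -/
theorem voronoiSepEvent.mono {δ : ℝ} {i : Fin 3} {z : ℂ} {B B' W W' : Set ℂ}
    (h : voronoiSepEvent D δ i z B W) (hB : B ⊆ B') (hBne : B.Nonempty) (hW : W' ⊆ W)
    (hW'ne : W'.Nonempty) : voronoiSepEvent D δ i z B' W' := by
  obtain ⟨x, hx, y, hy, γ, hγ, hcut⟩ := h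
  refine ⟨x, hx, y, hy, γ, fun t => ⟨(hγ t).1, ?_⟩, hcut⟩
  exact blackRegion_mono hB hBne hW hW'ne (hγ t).2

/-- A point of the arc `Aᵢ` inside `closure Ω` is never separated from `Aᵢ` (constant path).
[folklore] -/
theorem not_voronoiSepEvent_of_mem_arc {δ : ℝ} {i : Fin 3} {z : ℂ} {B W : Set ℂ}
    (hz : z ∈ D.arc i) : ¬ voronoiSepEvent D δ i z B W := by
  rintro ⟨x, -, y, -, γ, -, hcut⟩
  have hzX : z ∈ closure D.carrier := frontier_subset_closure (D.arc_subset_frontier i hz)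
  exact not_isCutBetween_of_mem hzX hz hcut

end SepEvent

/-! ### Annealed separating probabilities -/

section SepProb

open Literature.Probability.RandomPlanarGeometry (MarkedDomain)
open Literature.Analysis.FunctionSpaces (PointConfig)

/-- **The annealed Voronoi separating probability `fⁱ(z) = P[Eⁱ(z)]`** (Bollobás–Riordan's (9),
Ch. 7 p. 180, for random Voronoi percolation, Ch. 8 §8.1): the probability, under a joint law `P`
of the pair (black nuclei, white nuclei) of locally finite point configurations, that the
configuration `(c.1, c.2)` realises the separating event `voronoiSepEvent D δ i z`. For annealed
Poisson–Voronoi percolation `P = PB.prod PW` with `PB`, `PW` independent Poisson processes of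
Lebesgue intensity (route `CardyFlipRusso`, conjunct (i) of its `Target`); `Measure.real` of a
possibly non-measurable set (outer measure), as for the accepted crossing functional.
[cite: BollobasRiordan2006, Ch. 7 (9) p. 180] -/
def voronoiSepProb (P : Measure (PointConfig ℂ × PointConfig ℂ)) (D : MarkedDomain 3) (δ : ℝ)
    (i : Fin 3) (z : ℂ) : ℝ :=
  P.real {c | voronoiSepEvent D δ i z (c.1 : Set ℂ) (c.2 : Set ℂ)}

variable {P : Measure (PointConfig ℂ × PointConfig ℂ)} {D : MarkedDomain 3} {δ : ℝ} {i : Fin 3}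
  {z : ℂ}

/-- Unfolding lemma for `voronoiSepProb`. [cite: BollobasRiordan2006, Ch. 7 (9) p. 180] -/
theorem voronoiSepProb_eq (P : Measure (PointConfig ℂ × PointConfig ℂ)) (D : MarkedDomain 3)
    (δ : ℝ) (i : Fin 3) (z : ℂ) :
    voronoiSepProb P D δ i z = P.real {c | voronoiSepEvent D δ i z (c.1 : Set ℂ) (c.2 : Set ℂ)} :=
  rfl

/-- Separating probabilities are non-negative. [folklore] -/
theorem voronoiSepProb_nonneg : 0 ≤ voronoiSepProb P D δ i z :=
  measureReal_nonneg

/-- Under a probability law, separating probabilities are at most `1`. [folklore] -/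
theorem voronoiSepProb_le_one [IsProbabilityMeasure P] : voronoiSepProb P D δ i z ≤ 1 :=
  measureReal_le_one

/-- Under a probability law, separating probabilities lie in `[0, 1]` (the `mem_Icc` field of
`IsSeparatingData`). [cite: BollobasRiordan2006, Ch. 7 (9) p. 180] -/
theorem voronoiSepProb_mem_Icc [IsProbabilityMeasure P] :
    voronoiSepProb P D δ i z ∈ Icc (0 : ℝ) 1 :=
  ⟨voronoiSepProb_nonneg, voronoiSepProb_le_one⟩

/-- On the arc `Aᵢ` the separating probability `fⁱ` vanishes identically (deterministic part of the
boundary values (37); Bollobás–Riordan, proof of Claim 23, p. 200). [cite: BollobasRiordan2006, Ch. 7 p. 200] -/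
theorem voronoiSepProb_eq_zero_of_mem_arc (hz : z ∈ D.arc i) : voronoiSepProb P D δ i z = 0 := by
  have hset : {c : PointConfig ℂ × PointConfig ℂ |
      voronoiSepEvent D δ i z (c.1 : Set ℂ) (c.2 : Set ℂ)} = ∅ :=
    eq_empty_of_forall_notMem fun c hc => not_voronoiSepEvent_of_mem_arc hz hc
  rw [voronoiSepProb, hset, measureReal_empty]

end SepProb

end Literature.Probability.Percolation

end
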